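import Summits.HodgeConjecture.CorCM.TwoSexticFieldsGenerators
import Summits.HodgeConjecture.CorCM.SexticCMThreefoldPairPowersHodgeOfMarkman
import HarnessLib

/-!
# COR-CM — TWO sextic CM fields sharing `k`: the Hodge conjecture for ALL products of copies of `E`, `B₁`, `B₂`
# modulo Markman's fourfold theorem (assembly, frame form)

Cell `pub-hodgecm2` (COR-CM), seat b30 gen 16 (2026-08-21); COUNT-NEUTRAL; theorems only, no definition, no named fact,
no `sorry`.  Third file of the series TWO-FIELD-PAIR (`CorCM/TwoSexticFieldsFrameTransfer.lean`,
`CorCM/TwoSexticFieldsGenerators.lean`).  SETTING as there: `k = Kf i₀` (quadratic, `τ(δ) = i√d`), two sextic fields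
`K_m = Kf (tl m)` with `i m : k → K_m` and frames `e m` (`he_conj`, `he_sign`, JOINT `he_gal`), realisations
`A₃ j ⊨ (Kf (slots i₀ tl j); Φ₃ j)` (`E = A₃ 0 ⊨ (k; {τ})`, `B_{m+1} = A₃ (m+1)` of sign `true` exactly over the place
`m`), an arbitrary slot map `κ : Fin N → Fin 3` and the power `X = ⨁_j A₃ (κ j)` (any number of copies of `E`, `B₁`,
`B₂`, in any order).

* §1 `exists_weightClassesAlg_le_algebraicClasses_of_part₂` — a part `G` of a weight of `X` on which the configuration
  map `v = toPt₂ ∘ Sigma.map κ id` is injective and whose image is a generating weight has an algebraic weight line: the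
  projected weight of `Y = E × B₁ × B₂` is algebraic (conjugate pair: divisors; `weil4` / `pair6`: hypotheses), and THE
  DISTRIBUTION LEMMA `CMWeights.weightClassesAlg_comp_le_algebraicClasses_of_injOn` (gen 15) lifts it to `X`
  [cite: Milne2020HodgeClassesAV, 1.2 (a) and Thm. 1];
* §2 `hodgeConjectureFor_biproduct_comp_of_generators₂` — Pohlmann's theorem for the CM algebra `∏_j K_{κ j}`, the
  two-frame transfer `modelBalanced_of_isGaloisBalancedAlg₂`, the induction principle `modelBalanced_induction` for
  balanced configurations of the 14-point model (gen 15, `Census/DihedralSexticPairCurvePowers.lean`), §1, and the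
  multiplicativity of algebraic weight lines [cite: Pohlmann1968, Thm 1] [cite: GaoUllmo2025, Thm 3.1];
* §3 **`hodgeConjectureFor_biproduct_comp_of_frames_of_markman`** — `HodgeConjectureFor (⨁_j A₃ (κ j))` for EVERY `κ`,
  GIVEN ONLY `Markman2025_weilClasses_algebraic_abelianFourfold` (frame form: the two frames and the joint Galois
  hypothesis are explicit data), with the `AVDominatedBy`, «isogenous to a product of copies» and «all powers» corollaries
  [cite: Markman2025SurveySecant, Thm. 1.2] [cite: MoonenZarhin1999LowDim, Thm. 0.1].
The intrinsic form (hypotheses: `K₁ ≇ K₂` non-Galois sextic CM fields containing `k`, `B₁`, `B₂` simple) is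
`CorCM/TwoSexticFieldsThreefoldPairHodgeOfMarkman.lean`.  HONEST FRAMING: conditional on Markman only; `HC_CM` is not
asserted; wording of record untouched.

## References
* [Markman2025SurveySecant] E. Markman, arXiv:2509.23403, Thm. 1.2.  [Pohlmann1968] Ann. of Math. 88, Thm 1.
  [GaoUllmo2025] J. Inst. Math. Jussieu 25, Thm 3.1.  [Milne2020HodgeClassesAV] arXiv:2010.08857, 1.2 (a), Thm. 1.
  [MoonenZarhin1999LowDim] Duke 98 (1999), Thm. 0.1.  [MumfordAV1970] §19.
-/

noncomputable section

open CategoryTheory CategoryTheory.Limits NumberField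

namespace Summit.HodgeConjecture.CorCM.TwoSexticFields

open Literature.AlgebraicGeometry Literature.AlgebraicGeometry.Motives Literature.AlgebraicGeometry.HodgeTheory
open Literature.AlgebraicGeometry.ComplexMultiplication (IsCMTypeRealisation)
open Literature.AlgebraicGeometry.Pohlmann1968
open Summit.HodgeConjecture.CorCM.Census.DihedralSexticPairCurve (Pt' act' phi' conjPair weil4 pair6 gens mem_gens_iff
  gens_balanced)
open Summit.HodgeConjecture.CorCM.Census.DihedralSexticPairCurvePowers (ModelBalanced modelBalanced_induction)
open Summit.HodgeConjecture.CorCM.DihedralSexticPair (eq_or_eq_conjugate)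
open Summit.HodgeConjecture.CorCM.PairWeights (weightClassesAlg_union_le_algebraicClasses)
open Summit.HodgeConjecture.CorCM.CMWeights (weightClassesAlg_comp_le_algebraicClasses_of_injOn)

open scoped Classical

/-! ## §1 Generating parts of a weight of the power have algebraic lines -/

section Parts

variable {I : Type} {Kf : I → Type} [∀ i, Field (Kf i)] [∀ i, NumberField (Kf i)] [∀ i, IsCMField (Kf i)]
  {i₀ : I} {tl : Fin 2 → I} {N : ℕ} (κ : Fin N → Fin 3) {e : ∀ m : Fin 2, (Kf (tl m) →+* ℂ) ≃ ZMod 3 × Bool}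
  {τ : Kf i₀ →+* ℂ}
  (hττ : ComplexEmbedding.conjugate τ ≠ τ) (hk : ∀ σ : Kf i₀ →+* ℂ, σ = τ ∨ σ = ComplexEmbedding.conjugate τ)
  (he_conj : ∀ (m : Fin 2) (s : Kf (tl m) →+* ℂ), e m (ComplexEmbedding.conjugate s) = ((e m s).1, !(e m s).2))
  {A₃ : Fin 3 → AbelianVariety ℂ} {Φ₃ : ∀ m : Fin 3, CMType (Kf (slots i₀ tl m))}
  {ι₃ : ∀ m, 𝓞 (Kf (slots i₀ tl m)) →+* End (A₃ m)}
  {θ₃ : ∀ m, Kf (slots i₀ tl m) →+* Module.End ℂ (complexBetti (A₃ m).X 1)}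
  (hA : ∀ m, IsCMTypeRealisation (Φ₃ m) (A₃ m) (ι₃ m) (θ₃ m))
  (hweil4 : ∀ (m : Fin 2) (b : Bool) (T : Finset ((m : Fin 3) × (Kf (slots i₀ tl m) →+* ℂ))),
    T.image (toPt₂ e τ) = weil4 m b → weightClassesAlg A₃ ι₃ (2 * 2) T ≤ algebraicClasses (⨁ A₃).X 2)
  (hpair6 : ∀ (b : Bool) (T : Finset ((m : Fin 3) × (Kf (slots i₀ tl m) →+* ℂ))),
    T.image (toPt₂ e τ) = pair6 b → weightClassesAlg A₃ ι₃ (2 * 3) T ≤ algebraicClasses (⨁ A₃).X 3)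

include hττ hk he_conj hA hweil4 hpair6 in
/-- **A generating part of a weight of `X = ⨁_j A₃(κ j)` has an algebraic weight line (two frames).**  If
`v = toPt₂ ∘ P` (`P (j, s) = (κ j, s)`) is injective on `G` and `v(G)` is `conjPair y`, `weil4 m b` or `pair6 b`, then `G`
has `2q` elements (`q = 1, 2, 3`) and `H^{2q}(X)_G ⊆ N^q`: the projected weight `P(G)` of `Y = ⨁ A₃` has the same model
image, hence an algebraic line on `Y`, and the distribution lemma lifts it along `κ`.
[cite: Milne2020HodgeClassesAV, 1.2 (a) and Thm. 1] [cite: Markman2025SurveySecant, Thm. 1.2] -/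
theorem exists_weightClassesAlg_le_algebraicClasses_of_part₂
    {G : Finset ((j : Fin N) × (Kf (slots i₀ tl (κ j)) →+* ℂ))}
    (hinj : Set.InjOn (fun x => toPt₂ e τ ((Sigma.map κ (fun _ => id) :
      ((j : Fin N) × (Kf (slots i₀ tl (κ j)) →+* ℂ)) → ((m : Fin 3) × (Kf (slots i₀ tl m) →+* ℂ))) x)) ↑G)
    (hG : G.image (fun x => toPt₂ e τ ((Sigma.map κ (fun _ => id) :
      ((j : Fin N) × (Kf (slots i₀ tl (κ j)) →+* ℂ)) → ((m : Fin 3) × (Kf (slots i₀ tl m) →+* ℂ))) x))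
        ∈ gens) :
    ∃ q : ℕ, G.card = 2 * q ∧ weightClassesAlg (fun j => A₃ (κ j)) (fun j => ι₃ (κ j)) (2 * q) G ≤
      algebraicClasses (⨁ fun j => A₃ (κ j)).X q := by
  set P : ((j : Fin N) × (Kf (slots i₀ tl (κ j)) →+* ℂ)) → ((m : Fin 3) × (Kf (slots i₀ tl m) →+* ℂ)) :=
    Sigma.map κ (fun _ => id) with hP
  have hPinj : Set.InjOn P ↑G := fun x hx y hy h => hinj hx hy (by simp only [h])
  set TY : Finset ((m : Fin 3) × (Kf (slots i₀ tl m) →+* ℂ)) := G.image P with hTY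
  have hTYimg : TY.image (toPt₂ e τ) = G.image (fun x => toPt₂ e τ (P x)) := by rw [hTY, Finset.image_image]; rfl
  have hTYcard : TY.card = G.card := Finset.card_image_of_injOn hPinj
  have hGcard_img : G.card = (G.image fun x => toPt₂ e τ (P x)).card := (Finset.card_image_of_injOn hinj).symm
  -- the projected weight is algebraic on `Y`, of the right size
  obtain ⟨q, hq, hYalg⟩ : ∃ q, G.card = 2 * q ∧ weightClassesAlg A₃ ι₃ (2 * q) TY ≤ algebraicClasses (⨁ A₃).X q := by
    rcases (mem_gens_iff _).1 hG with ⟨y, hy⟩ | ⟨m, b, hy⟩ | hy | hy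
    · obtain ⟨hc, halg⟩ := weightClassesAlg_le_algebraicClasses_of_image_eq_conjPair₂ hττ hk he_conj hA
        (T := TY) (y := y) (by rw [hTYimg, hy])
      exact ⟨1, by rw [← hTYcard, hc], halg⟩
    · refine ⟨2, ?_, hweil4 m b TY (by rw [hTYimg, hy])⟩
      rw [hGcard_img, hy]; exact (gens_balanced.2.1 m b).2.1
    · refine ⟨3, ?_, hpair6 true TY (by rw [hTYimg, hy])⟩
      rw [hGcard_img, hy]; exact (gens_balanced.2.2 true).2.1
    · refine ⟨3, ?_, hpair6 false TY (by rw [hTYimg, hy])⟩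
      rw [hGcard_img, hy]; exact (gens_balanced.2.2 false).2.1
  -- the distribution lemma lifts it to `X`
  exact ⟨q, hq, weightClassesAlg_comp_le_algebraicClasses_of_injOn (K := fun m => Kf (slots i₀ tl m)) hA κ hq
    hPinj hYalg⟩

end Parts

/-! ## §2 Assembly from the generator hypotheses -/

section Assembly

variable {I : Type} {Kf : I → Type} [∀ i, Field (Kf i)] [∀ i, NumberField (Kf i)] [∀ i, IsCMField (Kf i)]
  {i₀ : I} {tl : Fin 2 → I} {N : ℕ} (κ : Fin N → Fin 3) {e : ∀ m : Fin 2, (Kf (tl m) →+* ℂ) ≃ ZMod 3 × Bool}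
  {τ : Kf i₀ →+* ℂ} {i : ∀ m : Fin 2, Kf i₀ →+* Kf (tl m)}
  {A₃ : Fin 3 → AbelianVariety ℂ} {Φ₃ : ∀ m : Fin 3, CMType (Kf (slots i₀ tl m))}
  {ι₃ : ∀ m, 𝓞 (Kf (slots i₀ tl m)) →+* End (A₃ m)}
  {θ₃ : ∀ m, Kf (slots i₀ tl m) →+* Module.End ℂ (complexBetti (A₃ m).X 1)}

/-- **`HodgeConjectureFor (⨁_j A₃ (κ j))` from the two frames, the joint Galois hypothesis and the two generator
hypotheses on `Y = E × B₁ × B₂`** (any slot map `κ`): every rational `(p,p)`-class of the power is algebraic.  Pohlmann's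
theorem for the CM algebra `∏_j K_{κ j}`, the two-frame transfer, the induction principle for balanced configurations of
the 14-point model, §1, and the multiplicativity of algebraic weight lines.
[cite: Pohlmann1968, Thm 1] [cite: GaoUllmo2025, Thm 3.1] [cite: Milne2020HodgeClassesAV, 1.2 (a) and Thm. 1] -/
theorem hodgeConjectureFor_biproduct_comp_of_generators₂
    (hττ : ComplexEmbedding.conjugate τ ≠ τ) (hk : ∀ σ : Kf i₀ →+* ℂ, σ = τ ∨ σ = ComplexEmbedding.conjugate τ)
    (hA : ∀ m, IsCMTypeRealisation (Φ₃ m) (A₃ m) (ι₃ m) (θ₃ m))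
    (he_conj : ∀ (m : Fin 2) (s : Kf (tl m) →+* ℂ), e m (ComplexEmbedding.conjugate s) = ((e m s).1, !(e m s).2))
    (he_sign : ∀ (m : Fin 2) (s : Kf (tl m) →+* ℂ), s.comp (i m) = τ ↔ (e m s).2 = true)
    (he_gal : ∀ (j : ZMod 3) (f : Bool), ∃ σ : ℂ ≃+* ℂ, ∀ (m : Fin 2) (s : Kf (tl m) →+* ℂ),
      e m ((σ : ℂ →+* ℂ).comp s) = ((if f then -(e m s).1 else (e m s).1) + j, (e m s).2))
    (hΨ : ∀ σ : Kf i₀ →+* ℂ, σ ∈ (Φ₃ 0).1 ↔ σ = τ)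
    (hΦ : ∀ (m : Fin 2) (s : Kf (tl m) →+* ℂ), s ∈ (Φ₃ m.succ).1 ↔ (e m s).2 = decide ((e m s).1.val = m.val))
    (hweil4 : ∀ (m : Fin 2) (b : Bool) (T : Finset ((m : Fin 3) × (Kf (slots i₀ tl m) →+* ℂ))),
      T.image (toPt₂ e τ) = weil4 m b → weightClassesAlg A₃ ι₃ (2 * 2) T ≤ algebraicClasses (⨁ A₃).X 2)
    (hpair6 : ∀ (b : Bool) (T : Finset ((m : Fin 3) × (Kf (slots i₀ tl m) →+* ℂ))),
      T.image (toPt₂ e τ) = pair6 b → weightClassesAlg A₃ ι₃ (2 * 3) T ≤ algebraicClasses (⨁ A₃).X 3) :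
    HodgeConjectureFor (⨁ fun j => A₃ (κ j)).dim (⨁ fun j => A₃ (κ j)).X := by
  refine ⟨nonempty_hodgeModel_holds (Motives.AbelianVariety.isSmoothProjective_holds (A := ⨁ fun j => A₃ (κ j))),
    fun p c hc hH => ?_⟩
  have hAκ : ∀ j, IsCMTypeRealisation (Φ₃ (κ j)) (A₃ (κ j)) (ι₃ (κ j)) (θ₃ (κ j)) := fun j => hA (κ j)
  -- every balanced configuration has algebraic weight lines: induct over its generating parts
  have key : ∀ (R : Finset ((j : Fin N) × (Kf (slots i₀ tl (κ j)) →+* ℂ))),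
      ModelBalanced (fun x => toPt₂ e τ ((Sigma.map κ (fun _ => id) :
        ((j : Fin N) × (Kf (slots i₀ tl (κ j)) →+* ℂ)) → ((m : Fin 3) × (Kf (slots i₀ tl m) →+* ℂ))) x)) R →
      ∀ q, R.card = 2 * q → weightClassesAlg (fun j => A₃ (κ j)) (fun j => ι₃ (κ j)) (2 * q) R ≤
        algebraicClasses (⨁ fun j => A₃ (κ j)).X q := by
    intro R hR
    refine modelBalanced_induction (motive := fun R => ∀ q, R.card = 2 * q →
      weightClassesAlg (fun j => A₃ (κ j)) (fun j => ι₃ (κ j)) (2 * q) R ≤ algebraicClasses (⨁ fun j => A₃ (κ j)).X q)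
      (fun q hq => ?_) (fun G R hGR hinj hG ih q hq => ?_) hR
    · obtain rfl : q = 0 := by simpa using hq.symm
      exact fun c _ => hodgeConjectureFor_codim_zero c
    · obtain ⟨a, ha, hGalg⟩ :=
        exists_weightClassesAlg_le_algebraicClasses_of_part₂ κ hττ hk he_conj hA hweil4 hpair6 hinj hG
      have hRcard : R.card = 2 * (q - a) := by
        have h := Finset.card_union_of_disjoint hGR
        rw [hq, ha] at h
        omega
      have haq : a + (q - a) = q := by
        have h := Finset.card_union_of_disjoint hGR
        rw [hq, ha] at h
        omega
      rw [← Finset.disjUnion_eq_union G R hGR]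
      exact weightClassesAlg_union_le_algebraicClasses hAκ haq ha hRcard hGR hGalg (ih (q - a) hRcard)
  have hmem : c ∈ ⨆ S ∈ pohlmannSetsAlg (K := fun j => Kf (slots i₀ tl (κ j))) (fun j => Φ₃ (κ j)) p,
      weightClassesAlg (fun j => A₃ (κ j)) (fun j => ι₃ (κ j)) (2 * p) S := by
    rw [← (Pohlmann1968_thm1_cmAlgebra (fun j => Kf (slots i₀ tl (κ j))) (fun j => A₃ (κ j))
      (fun j => Φ₃ (κ j)) (fun j => ι₃ (κ j)) (fun j => θ₃ (κ j)) hAκ p).1]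
    exact Submodule.subset_span ⟨hc, hH⟩
  have hle : (⨆ S ∈ pohlmannSetsAlg (K := fun j => Kf (slots i₀ tl (κ j))) (fun j => Φ₃ (κ j)) p,
      weightClassesAlg (fun j => A₃ (κ j)) (fun j => ι₃ (κ j)) (2 * p) S) ≤
      algebraicClasses (⨁ fun j => A₃ (κ j)).X p := by
    refine iSup₂_le fun S hS => ?_
    exact key S (modelBalanced_of_isGaloisBalancedAlg₂ hττ hk he_sign he_conj he_gal hΨ hΦ κ hS.2) p hS.1
  exact hle hmem

end Assembly

/-! ## §3 The frame form modulo Markman, and its corollaries -/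

section Markman

variable {I : Type} {Kf : I → Type} [∀ i, Field (Kf i)] [∀ i, NumberField (Kf i)] [∀ i, IsCMField (Kf i)]
  {i₀ : I} {tl : Fin 2 → I} {τ : Kf i₀ →+* ℂ}
  {A₃ : Fin 3 → AbelianVariety ℂ} {Φ₃ : ∀ m : Fin 3, CMType (Kf (slots i₀ tl m))}
  {ι₃ : ∀ m, 𝓞 (Kf (slots i₀ tl m)) →+* End (A₃ m)}
  {θ₃ : ∀ m, Kf (slots i₀ tl m) →+* Module.End ℂ (complexBetti (A₃ m).X 1)}

/-- **MAIN THEOREM (frame form, two fields).  The Hodge conjecture for every product of copies of `E`, `B₁`, `B₂` —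
`⨁_j A₃(κ j)`, i.e. `E^c × B₁^a × B₂^b` for all `a, b, c`, in any order — modulo Markman's fourfold theorem.**
`k = Kf i₀` imaginary quadratic with `τ(δ) = i√d`; TWO sextic fields `K_m = Kf (tl m) ⊇ i_m(k)` (`m = 0, 1`) read in
frames `e m` (conjugation flips the sign, sign `true` iff `s ∘ i_m = τ`) with the JOINT Galois hypothesis `he_gal`
(each sign-preserving affine move of `ℤ/3 × Bool` realised on both `Hom(K_m, ℂ)` by one automorphism of `ℂ`);
`A₃ 0 ⊨ (k; {τ})`, `A₃ (m+1) ⊨ (K_m; Φ_m)` with `Φ_m` of sign `true` exactly over the place `m`.  Then every rational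
`(p,p)`-class on `⨁_j A₃ (κ j)` is algebraic, for every slot map `κ : Fin N → Fin 3` and every `p`, GIVEN ONLY
`Markman2025_weilClasses_algebraic_abelianFourfold`. [cite: Markman2025SurveySecant, Thm. 1.2 and §11.5 Step 2]
[cite: Pohlmann1968, Thm 1] [cite: GaoUllmo2025, Thm 3.1] [cite: Milne2020HodgeClassesAV, Thm. 1]
[cite: MoonenZarhin1999LowDim, Thm. 0.1] -/
theorem hodgeConjectureFor_biproduct_comp_of_frames_of_markman {N : ℕ} (κ : Fin N → Fin 3)
    (hW4 : Markman2025_weilClasses_algebraic_abelianFourfold)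
    (h6 : ∀ m : Fin 2, Module.finrank ℚ (Kf (tl m)) = 6) (h2 : Module.finrank ℚ (Kf i₀) = 2)
    (i : ∀ m : Fin 2, Kf i₀ →+* Kf (tl m))
    {δ : 𝓞 (Kf i₀)} {d : ℕ} (hd : 0 < d) (hδ : ((δ : Kf i₀)) ^ 2 = -(d : Kf i₀))
    (hτ : τ (δ : Kf i₀) = Complex.I * (Real.sqrt d : ℂ))
    (hA : ∀ m, IsCMTypeRealisation (Φ₃ m) (A₃ m) (ι₃ m) (θ₃ m))
    (e : ∀ m : Fin 2, (Kf (tl m) →+* ℂ) ≃ ZMod 3 × Bool)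
    (he_conj : ∀ (m : Fin 2) (s : Kf (tl m) →+* ℂ), e m (ComplexEmbedding.conjugate s) = ((e m s).1, !(e m s).2))
    (he_sign : ∀ (m : Fin 2) (s : Kf (tl m) →+* ℂ), s.comp (i m) = τ ↔ (e m s).2 = true)
    (he_gal : ∀ (j : ZMod 3) (f : Bool), ∃ σ : ℂ ≃+* ℂ, ∀ (m : Fin 2) (s : Kf (tl m) →+* ℂ),
      e m ((σ : ℂ →+* ℂ).comp s) = ((if f then -(e m s).1 else (e m s).1) + j, (e m s).2))
    (hΨ : ∀ σ : Kf i₀ →+* ℂ, σ ∈ (Φ₃ 0).1 ↔ σ = τ)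
    (hΦ : ∀ (m : Fin 2) (s : Kf (tl m) →+* ℂ), s ∈ (Φ₃ m.succ).1 ↔ (e m s).2 = decide ((e m s).1.val = m.val)) :
    HodgeConjectureFor (⨁ fun j => A₃ (κ j)).dim (⨁ fun j => A₃ (κ j)).X :=
  hodgeConjectureFor_biproduct_comp_of_generators₂ κ (CMThreefoldPair.conjugate_ne_of_apply_eq hd hτ)
    (fun σ => eq_or_eq_conjugate h2 hd hτ σ) hA he_conj he_sign he_gal hΨ hΦ
    (fun m b T hT => weightClassesAlg_le_algebraicClasses_of_image_eq_weil4₂ hW4 h6 h2 hd hδ hτ hA he_sign hΨ hΦ m b T hT)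
    (fun b T hT => weightClassesAlg_le_algebraicClasses_of_image_eq_pair6₂ hW4 h6 h2 hd hδ hτ hA he_sign hΦ b T hT)

/-- **The one-copy case `κ = id`: the Hodge conjecture for `E × B₁ × B₂ = ⨁ A₃` itself** (frame form, modulo Markman).
[cite: Markman2025SurveySecant, Thm. 1.2] [cite: Pohlmann1968, Thm 1] -/
theorem hodgeConjectureFor_biproduct_of_frames_of_markman
    (hW4 : Markman2025_weilClasses_algebraic_abelianFourfold)
    (h6 : ∀ m : Fin 2, Module.finrank ℚ (Kf (tl m)) = 6) (h2 : Module.finrank ℚ (Kf i₀) = 2)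
    (i : ∀ m : Fin 2, Kf i₀ →+* Kf (tl m))
    {δ : 𝓞 (Kf i₀)} {d : ℕ} (hd : 0 < d) (hδ : ((δ : Kf i₀)) ^ 2 = -(d : Kf i₀))
    (hτ : τ (δ : Kf i₀) = Complex.I * (Real.sqrt d : ℂ))
    (hA : ∀ m, IsCMTypeRealisation (Φ₃ m) (A₃ m) (ι₃ m) (θ₃ m))
    (e : ∀ m : Fin 2, (Kf (tl m) →+* ℂ) ≃ ZMod 3 × Bool)
    (he_conj : ∀ (m : Fin 2) (s : Kf (tl m) →+* ℂ), e m (ComplexEmbedding.conjugate s) = ((e m s).1, !(e m s).2))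
    (he_sign : ∀ (m : Fin 2) (s : Kf (tl m) →+* ℂ), s.comp (i m) = τ ↔ (e m s).2 = true)
    (he_gal : ∀ (j : ZMod 3) (f : Bool), ∃ σ : ℂ ≃+* ℂ, ∀ (m : Fin 2) (s : Kf (tl m) →+* ℂ),
      e m ((σ : ℂ →+* ℂ).comp s) = ((if f then -(e m s).1 else (e m s).1) + j, (e m s).2))
    (hΨ : ∀ σ : Kf i₀ →+* ℂ, σ ∈ (Φ₃ 0).1 ↔ σ = τ)
    (hΦ : ∀ (m : Fin 2) (s : Kf (tl m) →+* ℂ), s ∈ (Φ₃ m.succ).1 ↔ (e m s).2 = decide ((e m s).1.val = m.val)) :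
    HodgeConjectureFor (⨁ A₃).dim (⨁ A₃).X :=
  hodgeConjectureFor_biproduct_comp_of_frames_of_markman (id : Fin 3 → Fin 3) hW4 h6 h2 i hd hδ hτ hA e he_conj he_sign
    he_gal hΨ hΦ

/-- **Every abelian variety dominated by a power `⨁_j A₃(κ j)`** (frame form, modulo Markman): abelian subvarieties,
quotients, isogeny factors of the products of copies of `E`, `B₁`, `B₂`. [cite: Markman2025SurveySecant, Thm. 1.2]
[cite: MumfordAV1970, §19] -/
theorem hodgeConjectureFor_of_avDominatedBy_comp_of_frames_of_markman {N : ℕ} (κ : Fin N → Fin 3)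
    (hW4 : Markman2025_weilClasses_algebraic_abelianFourfold)
    (h6 : ∀ m : Fin 2, Module.finrank ℚ (Kf (tl m)) = 6) (h2 : Module.finrank ℚ (Kf i₀) = 2)
    (i : ∀ m : Fin 2, Kf i₀ →+* Kf (tl m))
    {δ : 𝓞 (Kf i₀)} {d : ℕ} (hd : 0 < d) (hδ : ((δ : Kf i₀)) ^ 2 = -(d : Kf i₀))
    (hτ : τ (δ : Kf i₀) = Complex.I * (Real.sqrt d : ℂ))
    (hA : ∀ m, IsCMTypeRealisation (Φ₃ m) (A₃ m) (ι₃ m) (θ₃ m))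
    (e : ∀ m : Fin 2, (Kf (tl m) →+* ℂ) ≃ ZMod 3 × Bool)
    (he_conj : ∀ (m : Fin 2) (s : Kf (tl m) →+* ℂ), e m (ComplexEmbedding.conjugate s) = ((e m s).1, !(e m s).2))
    (he_sign : ∀ (m : Fin 2) (s : Kf (tl m) →+* ℂ), s.comp (i m) = τ ↔ (e m s).2 = true)
    (he_gal : ∀ (j : ZMod 3) (f : Bool), ∃ σ : ℂ ≃+* ℂ, ∀ (m : Fin 2) (s : Kf (tl m) →+* ℂ),
      e m ((σ : ℂ →+* ℂ).comp s) = ((if f then -(e m s).1 else (e m s).1) + j, (e m s).2))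
    (hΨ : ∀ σ : Kf i₀ →+* ℂ, σ ∈ (Φ₃ 0).1 ↔ σ = τ)
    (hΦ : ∀ (m : Fin 2) (s : Kf (tl m) →+* ℂ), s ∈ (Φ₃ m.succ).1 ↔ (e m s).2 = decide ((e m s).1.val = m.val))
    {B : AbelianVariety ℂ} (hB : Domination.AVDominatedBy B (⨁ fun j => A₃ (κ j))) :
    HodgeConjectureFor B.dim B.X :=
  Domination.hodgeConjectureFor_of_avDominatedBy
    (hodgeConjectureFor_biproduct_comp_of_frames_of_markman κ hW4 h6 h2 i hd hδ hτ hA e he_conj he_sign he_gal hΨ hΦ) hB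

/-- **Every abelian variety isogenous to SOME product of copies of `E`, `B₁`, `B₂`** (indexed by any finite type `J`,
classes `cls : J → Fin 3`) satisfies the Hodge conjecture (frame form, modulo Markman): re-index by `Fin N`
(`biproduct.reindex`) and apply the main theorem. [cite: Markman2025SurveySecant, Thm. 1.2] [cite: MumfordAV1970, §19] -/
theorem hodgeConjectureFor_of_isIsogenous_biproduct_comp_of_frames_of_markman
    (hW4 : Markman2025_weilClasses_algebraic_abelianFourfold)
    (h6 : ∀ m : Fin 2, Module.finrank ℚ (Kf (tl m)) = 6) (h2 : Module.finrank ℚ (Kf i₀) = 2)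
    (i : ∀ m : Fin 2, Kf i₀ →+* Kf (tl m))
    {δ : 𝓞 (Kf i₀)} {d : ℕ} (hd : 0 < d) (hδ : ((δ : Kf i₀)) ^ 2 = -(d : Kf i₀))
    (hτ : τ (δ : Kf i₀) = Complex.I * (Real.sqrt d : ℂ))
    (hA : ∀ m, IsCMTypeRealisation (Φ₃ m) (A₃ m) (ι₃ m) (θ₃ m))
    (e : ∀ m : Fin 2, (Kf (tl m) →+* ℂ) ≃ ZMod 3 × Bool)
    (he_conj : ∀ (m : Fin 2) (s : Kf (tl m) →+* ℂ), e m (ComplexEmbedding.conjugate s) = ((e m s).1, !(e m s).2))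
    (he_sign : ∀ (m : Fin 2) (s : Kf (tl m) →+* ℂ), s.comp (i m) = τ ↔ (e m s).2 = true)
    (he_gal : ∀ (j : ZMod 3) (f : Bool), ∃ σ : ℂ ≃+* ℂ, ∀ (m : Fin 2) (s : Kf (tl m) →+* ℂ),
      e m ((σ : ℂ →+* ℂ).comp s) = ((if f then -(e m s).1 else (e m s).1) + j, (e m s).2))
    (hΨ : ∀ σ : Kf i₀ →+* ℂ, σ ∈ (Φ₃ 0).1 ↔ σ = τ)
    (hΦ : ∀ (m : Fin 2) (s : Kf (tl m) →+* ℂ), s ∈ (Φ₃ m.succ).1 ↔ (e m s).2 = decide ((e m s).1.val = m.val))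
    {J : Type} [Fintype J] (cls : J → Fin 3) {X : AbelianVariety ℂ}
    (hX : AbelianVariety.IsIsogenous X (⨁ fun j => A₃ (cls j))) :
    HodgeConjectureFor X.dim X.X := by
  classical
  let ε : Fin (Fintype.card J) ≃ J := (Fintype.equivFin J).symm
  have eJ : (⨁ fun j => A₃ (cls j)) ≅ ⨁ fun l => A₃ (cls (ε l)) := (biproduct.reindex ε fun j => A₃ (cls j)).symm
  exact hodgeConjectureFor_of_avDominatedBy_comp_of_frames_of_markman (fun l => cls (ε l)) hW4 h6 h2 i hd hδ hτ hA e
    he_conj he_sign he_gal hΨ hΦ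
    (Domination.AVDominatedBy.of_isIsogenous hX ((Domination.AVDominatedBy.refl _).of_iso_right eJ))

/-- **… and ALL POWERS of such an abelian variety**: if `X ∼ ⨁_{j : J} A₃ (cls j)` then `HodgeConjectureFor (X^{N+1})`
for every `N` (every power is an isogeny factor of a product of copies, the tree's
`exists_avDominatedBy_powSucc_biproduct_slots_of_isIsogenous`), frame form, modulo Markman.
[cite: Markman2025SurveySecant, Thm. 1.2] [cite: Gordon1999HodgeAVSurvey, 7.6.1] [cite: MumfordAV1970, §19] -/
theorem hodgeConjectureFor_powSucc_of_isIsogenous_biproduct_comp_of_frames_of_markman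
    (hW4 : Markman2025_weilClasses_algebraic_abelianFourfold)
    (h6 : ∀ m : Fin 2, Module.finrank ℚ (Kf (tl m)) = 6) (h2 : Module.finrank ℚ (Kf i₀) = 2)
    (i : ∀ m : Fin 2, Kf i₀ →+* Kf (tl m))
    {δ : 𝓞 (Kf i₀)} {d : ℕ} (hd : 0 < d) (hδ : ((δ : Kf i₀)) ^ 2 = -(d : Kf i₀))
    (hτ : τ (δ : Kf i₀) = Complex.I * (Real.sqrt d : ℂ))
    (hA : ∀ m, IsCMTypeRealisation (Φ₃ m) (A₃ m) (ι₃ m) (θ₃ m))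
    (e : ∀ m : Fin 2, (Kf (tl m) →+* ℂ) ≃ ZMod 3 × Bool)
    (he_conj : ∀ (m : Fin 2) (s : Kf (tl m) →+* ℂ), e m (ComplexEmbedding.conjugate s) = ((e m s).1, !(e m s).2))
    (he_sign : ∀ (m : Fin 2) (s : Kf (tl m) →+* ℂ), s.comp (i m) = τ ↔ (e m s).2 = true)
    (he_gal : ∀ (j : ZMod 3) (f : Bool), ∃ σ : ℂ ≃+* ℂ, ∀ (m : Fin 2) (s : Kf (tl m) →+* ℂ),
      e m ((σ : ℂ →+* ℂ).comp s) = ((if f then -(e m s).1 else (e m s).1) + j, (e m s).2))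
    (hΨ : ∀ σ : Kf i₀ →+* ℂ, σ ∈ (Φ₃ 0).1 ↔ σ = τ)
    (hΦ : ∀ (m : Fin 2) (s : Kf (tl m) →+* ℂ), s ∈ (Φ₃ m.succ).1 ↔ (e m s).2 = decide ((e m s).1.val = m.val))
    {J : Type} [Fintype J] (cls : J → Fin 3) {X : AbelianVariety ℂ}
    (hX : AbelianVariety.IsIsogenous X (⨁ fun j => A₃ (cls j))) (N : ℕ) :
    HodgeConjectureFor (X.powSucc N).dim (X.powSucc N).X := by
  obtain ⟨n, ρ, hdom⟩ := exists_avDominatedBy_powSucc_biproduct_slots_of_isIsogenous hX N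
  exact hodgeConjectureFor_of_avDominatedBy_comp_of_frames_of_markman ρ hW4 h6 h2 i hd hδ hτ hA e he_conj he_sign
    he_gal hΨ hΦ hdom

end Markman

end Summit.HodgeConjecture.CorCM.TwoSexticFields

end
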